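import Literature.Computability.QuantumComplexity.ForrelationMemCorrect
import Literature.Computability.QuantumComplexity.PhaseQueryBQP
import Literature.Computability.QuantumComplexity.ForrelationIdleWires
import Literature.Computability.QuantumComplexity.ForrelationThm25EncodeFP
import Mathlib.Data.Fintype.Sum
import HarnessLib

/-!
# Explicit `k`-fold Forrelation is in `PromiseBQP`, VI: the amplitude and the membership theorem

Last file of the instantiation. For an instance `I = (n, k, C₀, …, C_{k-1})` with code `x`:

* the specification answers `Kv x = k + 1` active Hadamard layers and `Wv x = W := min(n, #R + 8)`
  active query wires (`R` the distinct read wires), and its phase predicate on layer `j` is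
  `[j ≤ k] ∧ C_{j-1}` read through the rank layout (`Pf_encode`); so by
  `PhaseQuery.phiFin_zero_eq_kForrelationValue` the return amplitude of the family is the `k`-fold
  forrelation `Φ_W` of the circuits laid out on `W` wires (`phiFin_encode`);
* **layout invariance** (`value_eq`, `phiFamily_eq`): with `Φ₀` the forrelation of the circuits on
  the `#R` read wires alone, `Φ(I) = Φ₀ · ρ_k^{n - #R}` and `Φ_W = Φ₀ · ρ_k^{W - #R}`, `ρ_k` the idle
  factor of `ForrelationIdleWires.lean` (`1` for odd `k`, `1/√2` for even `k`): a permutation of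
  the wires does not change `Φ` (`kForrelationValue_comp_equiv`) and idle wires scale it
  (`kForrelationValue_idle_pow`);
* hence (`accept_yes`, `accept_no`): on a yes-instance (`Φ(I) ≥ 3/5`) the family accepts with
  probability `≥ 2/3`, on a no-instance (`|Φ(I)| ≤ 1/100`) with probability `≤ 1/3` — when
  `n - #R > 8` and `k` is even, `|Φ_W| ≤ 2⁻⁴` and `|Φ(I)| < 3/5` settle both cases;
* **`AaronsonAmbainis2018_kForrelation_mem_holds : kForrelationProblem ∈ PromiseBQP`**
  (Aaronson–Ambainis 2018, §6, p. 26 with Prop. 6), and the completeness of explicit `k`-fold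
  Forrelation from the one remaining named fact, the `PromiseBQP`-hardness of sign-basis quantum
  simulation (`aaronson_ambainis_kForrelation_complete_of_hard`).

## References

* S. Aaronson, A. Ambainis, *Forrelation: a problem that optimally separates quantum from classical
  computing*, SIAM J. Comput. 47 (2018), §3.2 (Prop. 6), §6 (p. 26, Thm. 5) [AaronsonAmbainis2018].
-/

noncomputable section

namespace Literature.Computability.QuantumComplexity

open _root_.Computability Complexity Complexity.Brick Cryptography PhaseQuery

namespace ForrMem

variable (I : KForrelationInstance)

/-! ### Sizes -/

section Sizes

/-- `#R` (the number of distinct read wires). [folklore] -/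
abbrev sR : ℕ := (Rl I).length

/-- **The number of active query wires**: `W = min(n, #R + 8)`. [folklore] -/
def Wd : ℕ := min I.n (sR I + 8)

/-- `#R ≤ W`. [folklore] -/
theorem sR_le_Wd : sR I ≤ Wd I := le_min (length_Rl_le I) (Nat.le_add_right _ _)

/-- `W ≤ n`. [folklore] -/
theorem Wd_le_n : Wd I ≤ I.n := min_le_left _ _

/-- `dedupVals` does not lengthen. [folklore] -/
theorem length_dedupVals_le (l : List (List Bool)) : (dedupVals l).length ≤ l.length := by
  induction l using List.reverseRecOn with
  | nil => simp [dedupVals]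
  | append_singleton l a ih => rw [dedupVals_append_singleton]; split_ifs <;> simp <;> omega

/-- A gate reads at most as many wires as its code is long. [folklore] -/
theorem length_readsG_le {n : ℕ} (g : Gate (Fin n)) : (readsG g).length ≤ (encodeGate g).length := by
  have h1 : (readsG g).length ≤ g.arity := by
    rw [readsG, List.length_flatMap]
    have := List.sum_le_card_nsmul ((List.ofFn g.args).map fun w => (inlIdx w).length) 1 (fun x hx => by
      obtain ⟨w, -, rfl⟩ := List.mem_map.1 hx; cases w <;> simp [inlIdx])
    simpa using this
  have h2 : g.arity ≤ (encodeGate g).length := by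
    rw [encodeGate, length_boolPair, encodeCodeList_eq_encList, length_encList]
    have := List.card_nsmul_le_sum ((List.ofFn fun a => encodeWire n (g.args a)).map fun a => 2 * a.length + 2) 1
      (fun x hx => by obtain ⟨w, -, rfl⟩ := List.mem_map.1 hx; omega)
    simp only [List.length_map, List.length_ofFn, smul_eq_mul, mul_one] at this
    omega
  exact h1.trans h2

/-- A circuit reads at most as many wires as its code is long. [folklore] -/
theorem length_readsC_le {n : ℕ} (C : Circuit (Fin n)) : (readsC C).length ≤ (encodeCircuit C).length := by
  rw [readsC, List.length_append, List.length_flatMap, encodeCircuit, length_boolPair, encodeCodeList_eq_encList, length_encList,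
    List.map_map]
  have h1 : (C.gates.map fun g => (readsG g).length).sum ≤ (C.gates.map ((fun a => 2 * a.length + 2) ∘ encodeGate)).sum :=
    List.sum_le_sum fun g _ => by have := length_readsG_le g; simp only [Function.comp_apply]; omega
  have h2 : (inlIdx C.output).length ≤ 1 := by cases C.output <;> simp [inlIdx]
  omega

/-- **An instance reads at most `|x|` wires**, so `#R ≤ |x|`. [folklore] -/
theorem sR_le_length : sR I ≤ I.encode.length := by
  have h1 : sR I ≤ (occList I).length := by
    have := length_dedupVals_le ((occList I).map encodeNat); rw [List.length_map] at this; exact this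
  have h2 : (occList I).length ≤ (encList (List.ofFn fun i => encodeCircuit (I.C i))).length := by
    rw [occList, List.length_flatMap, length_encList,
      show (List.ofFn fun i => encodeCircuit (I.C i)) = (List.ofFn fun i => I.C i).map encodeCircuit by rw [List.map_ofFn]; rfl,
      show (List.ofFn fun i => readsC (I.C i)) = (List.ofFn fun i => I.C i).map readsC by rw [List.map_ofFn]; rfl,
      List.map_map, List.map_map]
    exact List.sum_le_sum fun C _ => by have := length_readsC_le C; simp only [Function.comp_apply]; omega
  have h3 : (encList (List.ofFn fun i => encodeCircuit (I.C i))).length ≤ I.encode.length := by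
    rw [KForrelationInstance.encode, encodeCodeList_eq_encList, length_boolPair, length_boolPair]; omega
  omega

/-- `k ≤ |x|` (every circuit code takes two symbols at least). [folklore] -/
theorem k_le_length : I.k ≤ I.encode.length := by
  have h : I.k ≤ (encList (List.ofFn fun i => encodeCircuit (I.C i))).length := by
    rw [length_encList]
    have := List.card_nsmul_le_sum ((List.ofFn fun i => encodeCircuit (I.C i)).map fun a => 2 * a.length + 2) 1
      (fun x hx => by obtain ⟨w, -, rfl⟩ := List.mem_map.1 hx; omega)
    simp only [List.length_map, List.length_ofFn, smul_eq_mul, mul_one] at this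
    omega
  rw [KForrelationInstance.encode, encodeCodeList_eq_encList, length_boolPair, length_boolPair]; omega

/-- `1 ≤ |x|`. [folklore] -/
theorem one_le_length : 1 ≤ I.encode.length := by
  rw [KForrelationInstance.encode, length_boolPair]; omega

/-- **`Kv x = k + 1`.** [folklore] -/
theorem Kv_encode : spec.Kv I.encode = I.k + 1 := by
  show (GkF I.encode).length = _
  rw [GkF_apply, (sndF_sndF_encode I).2.2, bitsToNat_encodeNat, min_eq_left (k_le_length I)]
  simp [ones]

/-- **`Wv x = W`.** [folklore] -/
theorem Wv_encode : spec.Wv I.encode = Wd I := by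
  show (GwF I.encode).length = _
  rw [GwF_apply, (sndF_sndF_encode I).2.1, bitsToNat_encodeNat, dedupVals_occAll_encode]
  simp [ones, Wd]

/-- `W ≤ Wq = |x| + 8`. [folklore] -/
theorem Wd_le_Wq : Wd I ≤ Wq params I.encode.length := by
  rw [(Ly_params _).2]; have := sR_le_length I; unfold Wd; omega

end Sizes

/-! ### The phase predicates through the rank layout -/

section Layout

/-- **Extension of a content of the first `m` ranks to an assignment**: input `i` reads position
`rank i` (`0` beyond `m`). [folklore] -/
def ext {m : ℕ} (v : Fin m → Bool) (i : Fin I.n) : Bool := if h : rank I i < m then v ⟨rank I i, h⟩ else false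

/-- The circuits read the same values through any two layouts that agree below `#R`. [folklore] -/
theorem eval_ext_eq {m m' : ℕ} (t : Fin I.k) (v : Fin m → Bool) (v' : Fin m' → Bool) (hm : sR I ≤ m) (hm' : sR I ≤ m')
    (h : ∀ (r : ℕ) (hr : r < sR I), v ⟨r, by omega⟩ = v' ⟨r, by omega⟩) :
    (I.C t).eval (ext I v) = (I.C t).eval (ext I v') := by
  refine eval_congr_reads _ fun i hi => ?_
  have hr := rank_lt_of_mem I (mem_occList_of_mem_readsC I t hi)
  simp only [ext, dif_pos (lt_of_lt_of_le hr hm), dif_pos (lt_of_lt_of_le hr hm')]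
  exact h _ hr

/-- The phase predicates of the amplitude theorem: layer `j ≥ 1` is circuit `j - 1` on `W` wires. [folklore] -/
def gW (j : ℕ) (v : Fin (Wd I) → Bool) : Bool :=
  if h : 1 ≤ j ∧ j ≤ I.k then (I.C ⟨j - 1, by omega⟩).eval (ext I v) else false

/-- **The phase predicate of the specification on an instance code.** [cite: AaronsonAmbainis2018, §6 (p. 26)] -/
theorem Pf_encode (y : Cryptography.QReg (Wq params I.encode.length)) (j : ℕ) (hj1 : 1 ≤ j) (hjL : j ≤ Ly params I.encode.length) :
    spec.Pf I.encode (List.ofFn y) j = (decide (j ≤ I.k) && gW I j (y ∘ Fin.castLE (Wd_le_Wq I))) := by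
  show Pf I.encode (List.ofFn y) j = _
  rw [(Ly_params _).1] at hjL
  rw [Pf, GphaseF_apply _ _ hjL (one_le_length I), phaseBitM_encode, gW, decide_eq_true hj1, Bool.true_and]
  by_cases hjk : j ≤ I.k
  · rw [dif_pos ⟨hj1, hjk⟩, dif_pos ⟨hj1, hjk⟩, decide_eq_true hjk, Bool.true_and, Bool.true_and]
    have e : (I.C ⟨j - 1, by omega⟩).eval (assign I (List.ofFn y)) = (I.C ⟨j - 1, by omega⟩).eval (ext I (y ∘ Fin.castLE (Wd_le_Wq I))) := by
      refine eval_congr_reads _ fun i hi => ?_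
      have hr := rank_lt_of_mem I (mem_occList_of_mem_readsC I _ hi)
      have hrW : rank I i < Wd I := lt_of_lt_of_le hr (sR_le_Wd I)
      have hrQ : rank I i < Wq params I.encode.length := lt_of_lt_of_le hrW (Wd_le_Wq I)
      simp only [assign, ext, dif_pos hrW, Function.comp_apply, Fin.castLE_mk]
      rw [List.getD_eq_getElem _ _ (by simpa using hrQ)]
      simp
    rw [e]
    generalize (I.C ⟨j - 1, by omega⟩).eval (ext I (y ∘ Fin.castLE (Wd_le_Wq I))) = b
    cases b <;> simp
  · simp [hjk]

/-- **The return amplitude of the family on an instance code** is the `k`-fold forrelation of the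
circuits laid out on `W` wires. [cite: AaronsonAmbainis2018, §3.2 (Prop. 6) and §6 (p. 26)] -/
theorem phiFin_encode (A : Language Bool) :
    phiFin params spec I.encode A (fun _ => false) = (kForrelationValue (fun t : Fin I.k => gW I (t.val + 1)) : ℂ) :=
  phiFin_zero_eq_kForrelationValue params spec I.encode A (fun j => gW I j) (Wd_le_Wq I)
    (by rw [(Ly_params _).1]; exact k_le_length I) (Kv_encode I) (Wv_encode I) (fun y j hj1 hjL => Pf_encode I y j hj1 hjL)

end Layout

/-! ### Layout invariance of `Φ` -/

section Invariance

/-- The forrelation of the circuits on the `#R` read wires alone. [folklore] -/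
def phi0 : ℝ := kForrelationValue (n := sR I) fun t : Fin I.k => fun w => (I.C t).eval (ext I w)

/-- **Idle wires**: laying the circuits out on `m ≥ #R` wires multiplies `Φ₀` by `ρ_k^{m - #R}`.
[cite: AaronsonAmbainis2018, §3.2] -/
theorem kForrelationValue_ext (m : ℕ) (hm : sR I ≤ m) :
    kForrelationValue (n := m) (fun t : Fin I.k => fun v => (I.C t).eval (ext I v)) = phi0 I * idleFactor I.k ^ (m - sR I) := by
  obtain ⟨d, rfl⟩ := Nat.exists_eq_add_of_le hm
  rw [Nat.add_sub_cancel_left, phi0, ← kForrelationValue_idle_pow]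
  congr 1
  funext t v
  exact eval_ext_eq I t v (fun j => v (Fin.castAdd d j)) (Nat.le_add_right _ _) le_rfl fun r hr => rfl

/-- **`Φ_W = Φ₀ · ρ_k^{W - #R}`.** [cite: AaronsonAmbainis2018, §3.2] -/
theorem phiFamily_eq : kForrelationValue (fun t : Fin I.k => gW I (t.val + 1)) = phi0 I * idleFactor I.k ^ (Wd I - sR I) := by
  rw [← kForrelationValue_ext I (Wd I) (sR_le_Wd I)]
  congr 1
  funext t v
  rw [gW, dif_pos ⟨Nat.le_add_left 1 t.val, t.isLt⟩]
  congr 2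

/-- The read wire of rank `r < #R`. [folklore] -/
def wireAt (r : Fin (sR I)) : Fin I.n :=
  ⟨bitsToNat ((Rl I)[r.val]), lt_of_mem_occList I ((mem_Rl_values_iff I _).1 (List.mem_map.2 ⟨_, List.getElem_mem r.isLt, rfl⟩))⟩

/-- The rank of the wire of rank `r` is `r`. [folklore] -/
theorem rank_wireAt (r : Fin (sR I)) : rank I (wireAt I r) = r.val := by
  have hnd := nodup_Rl_values I
  rw [rank, wireAt, rankIdx]
  simp only [bitsToNat_encodeNat]
  set f := List.findIdx (fun a => bitsToNat a == bitsToNat (Rl I)[r.val]) (Rl I) with hf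
  apply le_antisymm
  · apply Nat.le_of_not_lt
    intro hlt
    have := List.not_of_lt_findIdx hlt
    simp only [beq_eq_false_iff_ne, ne_eq] at this
    exact this rfl
  · by_contra hlt
    have hlt' : f < r.val := Nat.lt_of_not_le hlt
    have hlen : f < (Rl I).length := lt_trans hlt' r.isLt
    have h1 := List.findIdx_getElem (w := hlen)
    simp only [beq_iff_eq] at h1
    have h3 : ((Rl I).map bitsToNat)[f]'(by simpa using hlen) = ((Rl I).map bitsToNat)[r.val]'(by simp) := by
      simp only [List.getElem_map]; exact h1
    have := (List.Nodup.getElem_inj_iff hnd).1 h3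
    omega

/-- `wireAt` is injective. [folklore] -/
theorem wireAt_injective : Function.Injective (wireAt I) := fun r r' h => by
  have := congrArg (rank I) h
  rw [rank_wireAt, rank_wireAt] at this
  exact Fin.ext this

/-- The wire at the rank of a read wire is the wire. [folklore] -/
theorem wireAt_rank {i : Fin I.n} (h : rank I i < sR I) : wireAt I ⟨rank I i, h⟩ = i := Fin.ext (value_at_rank I h)

/-- **A permutation of the wires laying the read wires out by rank**: `π (rank i) = i` for every read
wire `i`. [folklore] -/
theorem exists_perm : ∃ π : Equiv.Perm (Fin I.n), ∀ (i : Fin I.n) (h : rank I i < sR I),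
    π (Fin.castLE (length_Rl_le I) ⟨rank I i, h⟩) = i := by
  classical
  let f : Fin I.n → Fin I.n := fun p => if h : p.val < sR I then wireAt I ⟨p.val, h⟩ else p
  obtain ⟨g, hg⟩ := Finset.exists_equiv_extend_of_card_eq (α := Fin I.n) (t := (Finset.univ : Finset (Fin I.n)))
    (by simp) (s := Finset.univ.filter fun p : Fin I.n => p.val < sR I) (f := f) (by simp) (by
      intro p hp p' hp' e
      simp only [Finset.coe_filter, Finset.mem_univ, true_and, Set.mem_setOf_eq] at hp hp'
      simp only [f, dif_pos hp, dif_pos hp'] at e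
      exact Fin.ext (by simpa using congrArg Fin.val (wireAt_injective I e)))
  refine ⟨g.trans (Equiv.subtypeUnivEquiv fun p => Finset.mem_univ p), fun i h => ?_⟩
  have hmem : Fin.castLE (length_Rl_le I) ⟨rank I i, h⟩ ∈ Finset.univ.filter fun p : Fin I.n => p.val < sR I := by simpa using h
  have := hg _ hmem
  simp only [Equiv.trans_apply, Equiv.subtypeUnivEquiv_apply]
  rw [this]
  simp only [f, Fin.val_castLE, dif_pos h]
  exact wireAt_rank I h

/-- **`Φ(I) = Φ₀ · ρ_k^{n - #R}`**: permute the read wires to the front (`kForrelationValue_comp_equiv`)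
and drop the idle ones (`kForrelationValue_idle_pow`). [cite: AaronsonAmbainis2018, §3.2 and §6] -/
theorem value_eq : I.value = phi0 I * idleFactor I.k ^ (I.n - sR I) := by
  obtain ⟨π, hπ⟩ := exists_perm I
  have hs := length_Rl_le I
  let H : Fin I.k → (Fin I.n → Bool) → Bool := fun t y => (I.C t).eval (ext I y)
  have step1 : (fun t : Fin I.k => (I.C t).eval) = fun t z => H t (z ∘ π) := by
    funext t z
    refine eval_congr_reads _ fun i hi => ?_
    have hr := rank_lt_of_mem I (mem_occList_of_mem_readsC I t hi)
    simp only [ext, dif_pos (lt_of_lt_of_le hr hs), Function.comp_apply]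
    rw [show (⟨rank I i, lt_of_lt_of_le hr hs⟩ : Fin I.n) = Fin.castLE hs ⟨rank I i, hr⟩ from rfl, hπ i hr]
  rw [KForrelationInstance.value, step1, kForrelationValue_comp_equiv π H]
  exact kForrelationValue_ext I I.n hs

/-- **The two layouts compared**: either `Φ_W = Φ(I)`, or `k` is even, more than `8` wires are idle
and exactly `8` of them are kept. [cite: AaronsonAmbainis2018, §3.2 and §6] -/
theorem phiFamily_cases :
    kForrelationValue (fun t : Fin I.k => gW I (t.val + 1)) = I.value ∨
      (I.k % 2 = 0 ∧ 8 < I.n - sR I ∧ kForrelationValue (fun t : Fin I.k => gW I (t.val + 1)) = phi0 I * idleFactor I.k ^ 8) := by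
  rw [phiFamily_eq, value_eq]
  have hsn := length_Rl_le I
  by_cases hfar : I.n - sR I ≤ 8
  · left
    have : Wd I = I.n := by unfold Wd; omega
    rw [this]
  · have hW : Wd I - sR I = 8 := by unfold Wd; omega
    rw [hW]
    rcases Nat.mod_two_eq_zero_or_one I.k with he | ho
    · exact Or.inr ⟨he, by omega, rfl⟩
    · left; rw [idleFactor_of_odd ho, one_pow, one_pow]

end Invariance

/-! ### Acceptance probabilities and membership -/

section Membership

/-- `(1/√2)^8 = 1/16`. [folklore] -/
theorem inv_sqrt_two_pow_eight : ((Real.sqrt 2)⁻¹) ^ 8 = 1 / 16 := by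
  rw [inv_pow, show (8 : ℕ) = 2 * 4 from rfl, pow_mul, Real.sq_sqrt (by norm_num : (0 : ℝ) ≤ 2)]; norm_num

/-- `(1/√2)^t ≤ 1/16` for `t ≥ 8`. [folklore] -/
theorem inv_sqrt_two_pow_le {t : ℕ} (ht : 8 ≤ t) : ((Real.sqrt 2)⁻¹) ^ t ≤ 1 / 16 := by
  rw [← inv_sqrt_two_pow_eight]
  exact pow_le_pow_of_le_one (inv_nonneg.2 (Real.sqrt_nonneg 2))
    (inv_le_one_of_one_le₀ (Real.one_le_sqrt.2 (by norm_num))) ht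

/-- The return amplitude of the family on an instance code, in absolute value. [folklore] -/
theorem norm_phiFin_encode (A : Language Bool) :
    ‖phiFin params spec I.encode A (fun _ => false)‖ = |kForrelationValue (fun t : Fin I.k => gW I (t.val + 1))| := by
  rw [phiFin_encode]; simp

/-- **Yes-instances are accepted with probability `≥ 2/3`.** [cite: AaronsonAmbainis2018, §6 (p. 26)] -/
theorem accept_yes (h : I.IsYes) (A : Language Bool) :
    (2 : ℝ) / 3 ≤ 1 - (1 - ‖phiFin params spec I.encode A fun _ => false‖ ^ 2) ^ 3 := by
  rw [norm_phiFin_encode]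
  obtain ⟨-, hv⟩ := h
  rcases phiFamily_cases I with e | ⟨he, hfar, e⟩
  · rw [e]
    exact accept_ge_of_amplitude (hv.trans (le_abs_self _)) (abs_kForrelationValue_le_one _)
  · exfalso
    have h1 : |I.value| ≤ 1 / 16 := by
      rw [value_eq, idleFactor_of_even he, abs_mul, abs_pow, abs_of_nonneg (inv_nonneg.2 (Real.sqrt_nonneg 2))]
      calc |phi0 I| * (Real.sqrt 2)⁻¹ ^ (I.n - sR I) ≤ 1 * (1 / 16) :=
            mul_le_mul (abs_kForrelationValue_le_one _) (inv_sqrt_two_pow_le hfar.le) (by positivity) zero_le_one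
        _ = 1 / 16 := one_mul _
    have h2 := le_abs_self I.value
    linarith

/-- **No-instances are accepted with probability `≤ 1/3`.** [cite: AaronsonAmbainis2018, §6 (p. 26)] -/
theorem accept_no (h : I.IsNo) (A : Language Bool) :
    1 - (1 - ‖phiFin params spec I.encode A fun _ => false‖ ^ 2) ^ 3 ≤ (1 : ℝ) / 3 := by
  rw [norm_phiFin_encode]
  obtain ⟨-, hv⟩ := h
  refine accept_le_of_amplitude ?_ (abs_nonneg _)
  rcases phiFamily_cases I with e | ⟨he, -, e⟩
  · rw [e]; linarith
  · rw [e, idleFactor_of_even he, abs_mul, abs_pow, abs_of_nonneg (inv_nonneg.2 (Real.sqrt_nonneg 2)), inv_sqrt_two_pow_eight]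
    calc |phi0 I| * (1 / 16) ≤ 1 * (1 / 16) := mul_le_mul_of_nonneg_right (abs_kForrelationValue_le_one _) (by norm_num)
      _ = 1 / 16 := one_mul _

/-- DISCHARGE of the named fact `AaronsonAmbainis2018_kForrelation_mem` (**Aaronson–Ambainis 2018,
§6, p. 26 with Prop. 6: explicit `k`-fold FORRELATION is in `PromiseBQP`**): the uniform
polynomial-size Clifford+T family `PhaseQuery.family ForrMem.params` — the `k`-query Forrelation
circuit of Fig. 2 on the distinct read wires, each phase query answered in the white-box manner by
running the given circuit on a clean reversible block, three runs OR-ed — decides the promise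
problem with error `≤ 1/3`. [cite: AaronsonAmbainis2018, §6 (p. 26) and §3.2 Prop. 6] -/
theorem _root_.Literature.Computability.QuantumComplexity.AaronsonAmbainis2018_kForrelation_mem_holds :
    AaronsonAmbainis2018_kForrelation_mem := by
  refine mem_PromiseBQP_of_spec params spec kForrelationProblem (fun x hx => ?_) (fun x hx => ?_)
  · obtain ⟨I, hI, rfl⟩ := hx
    exact accept_yes I hI 0
  · obtain ⟨I, hI, rfl⟩ := hx
    exact accept_no I hI 0

/-- **Completeness of explicit `k`-fold Forrelation from the hardness of sign-basis simulation**: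
with membership now proved, the vendored completeness statement
`aaronson_ambainis_kForrelation_complete` follows from the one remaining named fact
`AaronsonAmbainis2018_lemma24_sign_hard` (AA Lemma 24 in the sign basis).
[cite: AaronsonAmbainis2018, §6 (Thm. 5: Prop. 6, Lemma 24, Thm. 25)] -/
theorem _root_.Literature.Computability.QuantumComplexity.aaronson_ambainis_kForrelation_complete_of_hard
    (h24 : AaronsonAmbainis2018_lemma24_sign_hard) : aaronson_ambainis_kForrelation_complete :=
  aaronson_ambainis_kForrelation_complete_of_mem_of_hard AaronsonAmbainis2018_kForrelation_mem_holds h24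

end Membership

end ForrMem

end Literature.Computability.QuantumComplexity
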